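import Literature.Analysis.FluidPDE.KNSSThm52SliceBridge
import Literature.Analysis.FluidPDE.KNSSThm53OfWindow
import HarnessLib

/-!
# KNSS 2009, Theorem 5.2: the slice-wise facts `knss_axisymmetric_no_swirl(')` (discharge)

Analysis/FluidPDE proof file (everything proved; no definitions, no named facts) discharging the
two slice-wise renderings of Koch–Nadirashvili–Seregin–Šverák's Theorem 5.2 (Acta Math. 203
(2009) 83–105 = arXiv:0709.3599, §5, pp. 9–10: "Let `u` be a bounded weak solution of the
Navier–Stokes equations in `ℝ³ × (−∞, 0)`. Assume that `u` is axi-symmetric with no swirl. Then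
`u(x,t) = (0, 0, b₃(t))` for some bounded measurable function `b₃ : (−∞, 0) → ℝ`") recorded in
`SelfSimilarLiouville.lean`:

* `knss_axisymmetric_no_swirl_holds : knss_axisymmetric_no_swirl` (ns.S22-companion: every
  slice `u(t)`, `t < 0`, of a bounded ancient mild solution in the tree's duality form with
  measurable, axisymmetric, swirl-free slices is a.e. `β • e_z`);
* `knss_axisymmetric_no_swirl'_holds : knss_axisymmetric_no_swirl'` (its `ℝ³`-valued form: every
  such slice is a.e. a constant vector `b ∈ ℝ³`).

Both are one-line compositions of two theorems of the tree:

1. **the theorem as printed, proved**: `KNSS2009_liouville_axisymmetric_no_swirl_holds`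
   (`KNSSThm53OfWindow.lean`; printed class `u ∈ L^∞(ℝ³ × (−∞, 0))`, through §4 on finite
   windows `KNSS2009_regularity_boundedWeak_window_holds`, itself from the smoothing of bounded
   mild solutions `KNSS2009_mild_regularity_holds`, Lemma 3.1 and Galilean covariance, and the
   p. 10 assembly with Lemma 2.1 `KNSS2009_lemma21_halfball_holds`);
2. **the bridge from the printed class to the slice-wise class, proved**:
   `knss_axisymmetric_no_swirl_of_KNSS2009` / `knss_axisymmetric_no_swirl'_of_KNSS2009`
   (`KNSSThm52SliceBridge.lean`: the duality-form class with measurable slices is the printed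
   class up to a possibly non-measurable axial drift `c(t) e_z` — cf. the parasitic solutions
   `b(t)` of KNSS 2009, §1 p. 3 — which is invisible to the solenoidal tests and is removed by the
   drift lemma of `AncientMildDrift.lean`).

No statement of `SelfSimilarLiouville.lean` is touched; the facts stay `def`s and their users'
hypotheses `(h : knss_axisymmetric_no_swirl')` are now fed `knss_axisymmetric_no_swirl'_holds`.

## References

* G. Koch, N. Nadirashvili, G. Seregin, V. Šverák, *Liouville theorems for the Navier–Stokes
  equations and applications*, Acta Math. 203 (2009) 83–105 = arXiv:0709.3599: Theorem 5.2 and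
  its proof (§5, pp. 9–10), Lemma 2.1 (p. 5), Lemma 3.1 (p. 7), §4 p. 8 (Prop. 4.1,
  (4.6)–(4.11)), §1 p. 3 (the solutions `u(x,t) = b(t)`). [KochNadirashviliSereginSverak2009]
-/

noncomputable section

namespace Literature.Analysis.FluidPDE

/-- **KNSS 2009, Theorem 5.2 in the tree's slice-wise duality form (`knss_axisymmetric_no_swirl`),
PROVED**: a bounded ancient mild solution of Navier–Stokes (`ν = 1`) on `ℝ³` with measurable
slices which is axisymmetric with no swirl at every `t < 0` satisfies `u(t) = β(t) e_z` a.e. on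
every slice — the printed theorem (`KNSS2009_liouville_axisymmetric_no_swirl_holds`) composed with
the class bridge `knss_axisymmetric_no_swirl_of_KNSS2009`. [cite: KochNadirashviliSereginSverak2009, Thm 5.2 (arXiv pp. 9–10)] -/
theorem knss_axisymmetric_no_swirl_holds : knss_axisymmetric_no_swirl :=
  knss_axisymmetric_no_swirl_of_KNSS2009 KNSS2009_liouville_axisymmetric_no_swirl_holds

/-- **The `ℝ³`-valued slice-wise form of KNSS 2009, Theorem 5.2 (`knss_axisymmetric_no_swirl'`),
PROVED**: every slice `u(t)`, `t < 0`, of a bounded ancient mild solution on `ℝ³` with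
measurable, axisymmetric, swirl-free slices is a.e. a constant vector `b ∈ ℝ³` — the printed
theorem (`KNSS2009_liouville_axisymmetric_no_swirl_holds`) composed with the class bridge
`knss_axisymmetric_no_swirl'_of_KNSS2009` (`b = β e_z`). [cite: KochNadirashviliSereginSverak2009, Thm 5.2 (arXiv pp. 9–10)] -/
theorem knss_axisymmetric_no_swirl'_holds : knss_axisymmetric_no_swirl' :=
  knss_axisymmetric_no_swirl'_of_KNSS2009 KNSS2009_liouville_axisymmetric_no_swirl_holds

end Literature.Analysis.FluidPDE

end
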